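import Literature.Analysis.FluidPDE.HardSphereEuclideanTransferDefs
import Literature.Analysis.FluidPDE.HardSphereEuclideanScaling
import HarnessLib

/-!
# Transfer of the collision-by-collision hard-sphere flow between `ℝ^d` and the flat torus

Deterministic layer of the proof of **Alexander's theorem in `ℝ^d`**
(`Literature.Analysis.FluidPDE.HardSphereFlow.nonempty` of `HardSphereDynamics`, discharged in
`Literature.Analysis.FluidPDE.HardSphereEuclideanAlexander`). The theorem is already proved on
the flat torus (`HardSphereAlexander`: for `0 < ε < 1/2` the collision-by-collision flow
`Alexander.flow (Torus.geometry d) ε` of `HardSphereFlowConstruction` is almost everywhere good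
and preserves the Liouville measure — Gallagher–Saint-Raymond–Texier 2013 Prop. 4.1.1,
Cercignani–Illner–Pulvirenti 1994 Thm. 4.2.1 and App. 4.A, whose p. 111 notes that "the cases of
reflecting boundary conditions and `Λ = ℝ³` can be treated similarly"; GST state Prop. 4.1.1 in
`ℝ^{2dN}`). We transfer it to `ℝ^d` through the map `z ↦ P (L⁻¹ z)` (`Alexander.projConfig`,
`HardSphereEuclideanTransferDefs`; the rescaling is the exact symmetry of
`HardSphereEuclideanScaling`): on data with bounded positions and energy, and for bounded
times, `L` can be taken so large that all particles stay in the ball of radius `1/4`, where the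
projection is a chart of the torus geometry, so that the two collision-by-collision dynamics
coincide. This file proves exactly that:

* the chart `‖x_i‖ < 1/4`, in which the minimal-image separation vectors of the projected
  configuration are the Euclidean ones (`sepVec_projConfig`), whence the hard-sphere domains,
  contact sets, incoming / outgoing pairs, elastic collisions, incoming contact pairs, simple
  incoming collision configurations and the time-`0` conventions of the two geometries correspond
  (section `Chart`);
* **exit times** agree below the chart horizon (`min_freeExitTime_projConfig`) and the collision
  step commutes with the projection (`projConfig_collisionStep`);
* for **chart-safe data** (`Alexander.IsChartSafe T z`: `‖x_i‖ ≤ ρ`, `E(z) ≤ V²/2`,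
  `ρ + (T + 1) V < 1/4`) positions grow at most linearly along the dynamics
  (`norm_fst_stateAfter_le`: energy is conserved and collisions do not move particles), so below
  the horizon `T + 1` the collision instants agree and the torus states are the projections of
  the Euclidean ones (`IsChartSafe.transfer_stateAfter`); consequently the collision counts, the
  forward flows, their left-continuous versions and the two-sided flows agree up to time `T`
  (`IsChartSafe.projConfig_fwdFlow`, `…_fwdFlowLeft`, `…_flow`), truncated forward regularity
  `FwdGoodUpTo` (`HardSphereFlowRestart`) transfers (`IsChartSafe.fwdGoodUpTo_projConfig_iff`),
  and so does the truncated good set `Alexander.goodUpTo`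
  (`IsChartSafe.projConfig_mem_goodUpTo_iff`; its scaling invariance is `smul_mem_goodUpTo_iff`).

## Mathlib / Literature reuse

The construction (`freeExitTime`, `collisionStep`, `stateAfter`, `collisionInstant`,
`collisionCount(Before)`, `fwdFlow(Left)`, `flow`, `IsSimpleIncoming`, `FwdGood`, `good`) is
`HardSphereFlowConstruction`'s, `FwdGoodUpTo` is `HardSphereFlowRestart`'s, the exit-time bounds
(`le_freeExitTime_of_forall_mem`, `freeFlight_mem_hardSphereDomain_of_lt`) are
`HardSphereFlowOrbits`', energy conservation (`configEnergy_stateAfter`,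
`norm_vel_le_of_configEnergy_le`) and the chart additivity of the minimal image
(`Torus.reprSym_add_proj_of_norm_lt`) are `HardSphereTorusMeasure`'s; `Torus.proj` is
`FunctionSpaces.FlatTorus`'. `Nat.sSup_mem`, `Nat.sSup_of_not_bddAbove`,
`ENNReal.add_lt_add_iff_left`, `ENNReal.toReal_lt_of_lt_ofReal` are Mathlib's. Mathlib has no
billiard / hard-sphere flow.

## Design choices

* The induction `IsChartSafe.transfer_stateAfter` is symmetric in the two dynamics (its
  hypothesis is that the `k`-th instant of *either* side is below the horizon), so that both
  directions of the transfer of `FwdGoodUpTo` follow from it; no regularity of the orbit is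
  needed for the conjugacy itself, only chart-safety.
* The pair selection `Set.Nonempty.some` in `collisionStep` is handled by the congruence
  `Alexander.dite_nonempty_some_congr` of `HardSphereEuclideanScaling` (equal sets of incoming
  pairs give equal steps), so no uniqueness of the incoming pair is required.
* Horizons: statements "up to time `T`" use the chart up to time `T + 1`, which absorbs all
  boundary cases (`t_{k+1} = T`, exit exactly at the horizon).

## References

* I. Gallagher, L. Saint-Raymond, B. Texier, *From Newton to Boltzmann: hard spheres and
  short-range potentials*, EMS (2013), arXiv:1208.5753, §4.1, Prop. 4.1.1 (= Prop. 2.1.1 of the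
  arXiv text, stated in `ℝ^{2dN}`) and its proof (balls `B_R^N × B_R^N`, horizons `t_n → ∞`).
* C. Cercignani, R. Illner, M. Pulvirenti, *The Mathematical Theory of Dilute Gases*, Springer
  (1994), §4.2 Thm. 4.2.1, App. 4.A pp. 107–111 (torus), p. 111 ("`Λ = ℝ³` similarly").
* R. K. Alexander, *The infinite hard sphere system*, Ph.D. thesis, UC Berkeley (1975).
-/

open Set Filter Topology Function MeasureTheory Metric
open scoped ENNReal InnerProductSpace

namespace Literature.Analysis.FluidPDE

noncomputable section

section Kinetic

variable {d : Type*} [Fintype d] {N : ℕ}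

/-! ## The projection to the torus -/

section Projection

namespace Alexander

/-- The projection commutes with free flight (`proj` is additive). [folklore] -/
theorem projConfig_freeFlight (t : ℝ) (z : Config N d (EuclideanSpace ℝ d)) :
    projConfig (freeFlight (Euclidean.geometry d) t z) = freeFlight (Torus.geometry d) t (projConfig z) := by
  funext i
  simp only [projConfig, freeFlight_apply, Euclidean.geometry_translate, Torus.geometry_translate,
    FunctionSpaces.Torus.proj_add]

omit [Fintype d] in
/-- The projection commutes with the velocity flip. [folklore] -/
theorem projConfig_flipVel (z : Config N d (EuclideanSpace ℝ d)) :
    projConfig (flipVel z) = flipVel (projConfig z) := rfl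

/-- The projection does not change the kinetic energy. [folklore] -/
@[simp]
theorem configEnergy_projConfig (z : Config N d (EuclideanSpace ℝ d)) :
    configEnergy (projConfig z) = configEnergy z := rfl

/-- In the chart `‖u‖ < 1/2` the symmetric representative of `proj u` is `u` itself. [folklore] -/
theorem _root_.Literature.Analysis.FluidPDE.Torus.reprSym_proj_of_norm_lt {u : EuclideanSpace ℝ d}
    (hu : ‖u‖ < 1 / 2) : Torus.reprSym (FunctionSpaces.Torus.proj u) = u := by
  have h := Torus.reprSym_add_proj_of_norm_lt (x := (0 : UnitAddTorus d)) (s := u)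
    (by simpa using hu)
  simpa using h

/-- **The chart identity**: if all positions have norm `< 1/4`, the minimal-image separation
vectors of the projected configuration are the Euclidean ones. [folklore] -/
theorem sepVec_projConfig {z : Config N d (EuclideanSpace ℝ d)} (hz : ∀ i, ‖(z i).1‖ < 4⁻¹)
    (i j : Fin N) :
    (Torus.geometry d).sepVec (projConfig z i).1 (projConfig z j).1 =
      (Euclidean.geometry d).sepVec (z i).1 (z j).1 := by
  have hsub : FunctionSpaces.Torus.proj (z i).1 - FunctionSpaces.Torus.proj (z j).1 =
      FunctionSpaces.Torus.proj ((z i).1 - (z j).1) := rfl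
  simp only [projConfig, Torus.geometry_sepVec, Euclidean.geometry_sepVec]
  rw [hsub]
  refine Torus.reprSym_proj_of_norm_lt ?_
  calc ‖(z i).1 - (z j).1‖ ≤ ‖(z i).1‖ + ‖(z j).1‖ := norm_sub_le _ _
    _ < 4⁻¹ + 4⁻¹ := add_lt_add (hz i) (hz j)
    _ = 1 / 2 := by norm_num

/-! ### Transfer at a configuration inside the chart -/

section Chart

variable {ε : ℝ} {z : Config N d (EuclideanSpace ℝ d)}

/-- Inside the chart, the projection respects the hard-sphere domains. [folklore] -/
theorem projConfig_mem_hardSphereDomain_iff (hz : ∀ i, ‖(z i).1‖ < 4⁻¹) :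
    projConfig z ∈ hardSphereDomain (Torus.geometry d) N ε ↔
      z ∈ hardSphereDomain (Euclidean.geometry d) N ε := by
  simp only [mem_hardSphereDomain, sepVec_projConfig hz]

/-- Inside the chart, the projection respects the contact sets. [folklore] -/
theorem projConfig_mem_contactSet_iff (hz : ∀ i, ‖(z i).1‖ < 4⁻¹) {i j : Fin N} :
    projConfig z ∈ contactSet (Torus.geometry d) N ε i j ↔
      z ∈ contactSet (Euclidean.geometry d) N ε i j := by
  rw [mem_contactSet, mem_contactSet, projConfig_mem_hardSphereDomain_iff hz, sepVec_projConfig hz]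

/-- Inside the chart, the projection respects incoming pairs. [folklore] -/
theorem isIncoming_projConfig_iff (hz : ∀ i, ‖(z i).1‖ < 4⁻¹) {i j : Fin N} :
    IsIncoming (Torus.geometry d) (projConfig z) i j ↔ IsIncoming (Euclidean.geometry d) z i j := by
  rw [IsIncoming, IsIncoming, sepVec_projConfig hz, projConfig_apply_snd, projConfig_apply_snd]

/-- Inside the chart, the projection respects outgoing pairs. [folklore] -/
theorem isOutgoing_projConfig_iff (hz : ∀ i, ‖(z i).1‖ < 4⁻¹) {i j : Fin N} :
    IsOutgoing (Torus.geometry d) (projConfig z) i j ↔ IsOutgoing (Euclidean.geometry d) z i j := by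
  rw [IsOutgoing, IsOutgoing, sepVec_projConfig hz, projConfig_apply_snd, projConfig_apply_snd]

/-- Inside the chart, the projection respects the incoming contact pairs. [folklore] -/
theorem incomingPairs_projConfig (hz : ∀ i, ‖(z i).1‖ < 4⁻¹) :
    incomingPairs (Torus.geometry d) ε (projConfig z) = incomingPairs (Euclidean.geometry d) ε z := by
  ext p
  simp only [mem_incomingPairs, projConfig_mem_contactSet_iff hz, isIncoming_projConfig_iff hz]

/-- Inside the chart, the projection respects simple incoming collision configurations. [folklore] -/
theorem isSimpleIncoming_projConfig_iff (hz : ∀ i, ‖(z i).1‖ < 4⁻¹) :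
    IsSimpleIncoming (Torus.geometry d) ε (projConfig z) ↔
      IsSimpleIncoming (Euclidean.geometry d) ε z := by
  simp only [IsSimpleIncoming, isIncoming_projConfig_iff hz, projConfig_mem_contactSet_iff hz]

omit [Fintype d] in
/-- The projection commutes with updating one particle. [folklore] -/
theorem projConfig_update (z : Config N d (EuclideanSpace ℝ d)) (i : Fin N)
    (a : EuclideanSpace ℝ d × EuclideanSpace ℝ d) :
    projConfig (Function.update z i a) =
      Function.update (projConfig z) i (FunctionSpaces.Torus.proj a.1, a.2) := by
  funext k
  by_cases hk : k = i
  · subst hk; simp [projConfig]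
  · simp [projConfig, Function.update_of_ne hk]

/-- Inside the chart, the projection commutes with the elastic collision of a pair. [folklore] -/
theorem projConfig_collidePair (hz : ∀ i, ‖(z i).1‖ < 4⁻¹) (i j : Fin N) :
    projConfig (collidePair (Euclidean.geometry d) i j z) =
      collidePair (Torus.geometry d) i j (projConfig z) := by
  rw [collidePair, collidePair, projConfig_update, projConfig_update, sepVec_projConfig hz]
  rfl

/-- Inside the chart, the projection of the time-`0` conventions of the good set: contact pairs
are outgoing and form at most one unordered pair. [folklore] -/
theorem projConfig_conventions_iff (hz : ∀ i, ‖(z i).1‖ < 4⁻¹) :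
    (∀ i j : Fin N, i ≠ j → projConfig z ∈ contactSet (Torus.geometry d) N ε i j →
      IsOutgoing (Torus.geometry d) (projConfig z) i j ∧
        ∀ i' j' : Fin N, i' ≠ j' → projConfig z ∈ contactSet (Torus.geometry d) N ε i' j' →
          ({i', j'} : Finset (Fin N)) = {i, j}) ↔
    (∀ i j : Fin N, i ≠ j → z ∈ contactSet (Euclidean.geometry d) N ε i j →
      IsOutgoing (Euclidean.geometry d) z i j ∧
        ∀ i' j' : Fin N, i' ≠ j' → z ∈ contactSet (Euclidean.geometry d) N ε i' j' →
          ({i', j'} : Finset (Fin N)) = {i, j}) := by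
  simp only [projConfig_mem_contactSet_iff hz, isOutgoing_projConfig_iff hz]

end Chart

/-! ### Exit times inside the chart -/

section ExitTime

variable {ε : ℝ} {z : Config N d (EuclideanSpace ℝ d)} {h : ℝ}

/-- **Exit times agree below the chart horizon**: if the free flight of `z` stays in the chart
for times in `[0, h)`, then `min τ_T(P z) h = min τ_E(z) h`. [folklore] -/
theorem min_freeExitTime_projConfig
    (hsafe : ∀ t : ℝ, 0 ≤ t → t < h → ∀ i, ‖(freeFlight (Euclidean.geometry d) t z i).1‖ < 4⁻¹) :
    min (freeExitTime (Torus.geometry d) ε (projConfig z)) (ENNReal.ofReal h) =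
      min (freeExitTime (Euclidean.geometry d) ε z) (ENNReal.ofReal h) := by
  refine le_antisymm (le_min ?_ (min_le_right _ _)) (le_min ?_ (min_le_right _ _))
  · refine le_freeExitTime_of_forall_mem fun t ht hlt => ?_
    have hth : t < h := (ENNReal.ofReal_lt_ofReal_iff_of_nonneg ht).1 (hlt.trans_le (min_le_right _ _))
    have hmem := freeFlight_mem_hardSphereDomain_of_lt (G := Torus.geometry d) (ε := ε)
      (z := projConfig z) ht (hlt.trans_le (min_le_left _ _))
    rwa [← projConfig_freeFlight, projConfig_mem_hardSphereDomain_iff (hsafe t ht hth)] at hmem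
  · refine le_freeExitTime_of_forall_mem fun t ht hlt => ?_
    have hth : t < h := (ENNReal.ofReal_lt_ofReal_iff_of_nonneg ht).1 (hlt.trans_le (min_le_right _ _))
    have hmem := freeFlight_mem_hardSphereDomain_of_lt (G := Euclidean.geometry d) (ε := ε)
      (z := z) ht (hlt.trans_le (min_le_left _ _))
    rw [← projConfig_mem_hardSphereDomain_iff (hsafe t ht hth), projConfig_freeFlight] at hmem
    exact hmem

/-- `min a H = min b H` and `b < H` force `a = b`. [folklore] -/
theorem eq_of_min_eq_min_of_lt {a b H : ℝ≥0∞} (h : min a H = min b H) (hb : b < H) : a = b := by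
  rw [min_eq_left hb.le] at h
  rcases le_total a H with ha | ha
  · rwa [min_eq_left ha] at h
  · rw [min_eq_right ha] at h
    exact absurd h hb.ne'

/-- Below the chart horizon the exit times agree (Euclidean hypothesis). [folklore] -/
theorem freeExitTime_projConfig_eq_of_lt
    (hsafe : ∀ t : ℝ, 0 ≤ t → t < h → ∀ i, ‖(freeFlight (Euclidean.geometry d) t z i).1‖ < 4⁻¹)
    (hlt : freeExitTime (Euclidean.geometry d) ε z < ENNReal.ofReal h) :
    freeExitTime (Torus.geometry d) ε (projConfig z) = freeExitTime (Euclidean.geometry d) ε z :=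
  eq_of_min_eq_min_of_lt (min_freeExitTime_projConfig hsafe) hlt

/-- Below the chart horizon the exit times agree (torus hypothesis). [folklore] -/
theorem freeExitTime_projConfig_eq_of_lt'
    (hsafe : ∀ t : ℝ, 0 ≤ t → t < h → ∀ i, ‖(freeFlight (Euclidean.geometry d) t z i).1‖ < 4⁻¹)
    (hlt : freeExitTime (Torus.geometry d) ε (projConfig z) < ENNReal.ofReal h) :
    freeExitTime (Torus.geometry d) ε (projConfig z) = freeExitTime (Euclidean.geometry d) ε z :=
  (eq_of_min_eq_min_of_lt (min_freeExitTime_projConfig hsafe).symm hlt).symm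

/-- The positions reached by a collision step are those of the free flight up to the exit time
(collisions do not move particles). [folklore] -/
theorem collisionStep_apply_fst {X : Type*} {G : Geometry d X} {y : Config N d X}
    (hτ : freeExitTime G ε y ≠ ∞) (i : Fin N) :
    (collisionStep G ε y i).1 = (freeFlight G (freeExitTime G ε y).toReal y i).1 := by
  rw [collisionStep, if_neg hτ]
  split_ifs
  · exact collidePair_apply_fst _ _
  · rfl

/-- **The collision step commutes with the projection** when the exit times agree and are finite
and the exit configuration lies in the chart. [folklore] -/
theorem projConfig_collisionStep
    (hτ : freeExitTime (Torus.geometry d) ε (projConfig z) = freeExitTime (Euclidean.geometry d) ε z)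
    (hfin : freeExitTime (Euclidean.geometry d) ε z ≠ ∞)
    (hz' : ∀ i, ‖(freeFlight (Euclidean.geometry d) (freeExitTime (Euclidean.geometry d) ε z).toReal
      z i).1‖ < 4⁻¹) :
    collisionStep (Torus.geometry d) ε (projConfig z) =
      projConfig (collisionStep (Euclidean.geometry d) ε z) := by
  rw [collisionStep, if_neg (by rwa [hτ]), collisionStep, if_neg hfin]
  dsimp only
  rw [hτ, ← projConfig_freeFlight,
    apply_dite (fun w : Config N d (EuclideanSpace ℝ d) => projConfig w)]
  simp_rw [projConfig_collidePair hz']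
  exact dite_nonempty_some_congr (incomingPairs_projConfig hz')
    (fun p => collidePair (Torus.geometry d) p.1 p.2 _) _

end ExitTime

/-! ### Bounded data: the orbit stays in the chart up to the horizon -/

section Bounded

variable {ε T : ℝ} {z : Config N d (EuclideanSpace ℝ d)}

/-- Under free flight in `ℝ^d` positions move by at most `|t| ‖v_i‖`. [folklore] -/
theorem norm_fst_freeFlight_le (t : ℝ) (y : Config N d (EuclideanSpace ℝ d)) (i : Fin N) :
    ‖(freeFlight (Euclidean.geometry d) t y i).1‖ ≤ ‖(y i).1‖ + |t| * ‖(y i).2‖ := by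
  rw [freeFlight_apply, Euclidean.geometry_translate]
  calc ‖(y i).1 + t • (y i).2‖ ≤ ‖(y i).1‖ + ‖t • (y i).2‖ := norm_add_le _ _
    _ = ‖(y i).1‖ + |t| * ‖(y i).2‖ := by rw [norm_smul, Real.norm_eq_abs]

/-- **Positions grow at most linearly along the collision-by-collision dynamics**: at a finite
instant `t_k`, `‖x_i(z_k)‖ ≤ ρ + t_k V` if `‖x_i(z)‖ ≤ ρ` and `E(z) ≤ V²/2`. [folklore] -/
theorem norm_fst_stateAfter_le {ρ V : ℝ} (hρ : ∀ i, ‖(z i).1‖ ≤ ρ)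
    (hE : configEnergy z ≤ V ^ 2 / 2) (hV : 0 ≤ V) {k : ℕ}
    (hk : collisionInstant (Euclidean.geometry d) ε z k ≠ ∞) (i : Fin N) :
    ‖(stateAfter (Euclidean.geometry d) ε z k i).1‖ ≤
      ρ + (collisionInstant (Euclidean.geometry d) ε z k).toReal * V := by
  induction k generalizing i with
  | zero => simpa using hρ i
  | succ k ih =>
    rw [collisionInstant_succ, ENNReal.add_ne_top] at hk
    have hv : ‖(stateAfter (Euclidean.geometry d) ε z k i).2‖ ≤ V :=
      norm_vel_le_of_configEnergy_le hV (by rw [configEnergy_stateAfter]; exact hE) i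
    rw [stateAfter_succ, collisionStep_apply_fst hk.2, collisionInstant_succ,
      ENNReal.toReal_add hk.1 hk.2, add_mul, ← add_assoc]
    refine (norm_fst_freeFlight_le _ _ i).trans (add_le_add (ih hk.1 i) ?_)
    rw [abs_of_nonneg ENNReal.toReal_nonneg]
    exact mul_le_mul_of_nonneg_left hv ENNReal.toReal_nonneg

namespace IsChartSafe

/-- Chart-safety is monotone in the horizon. [folklore] -/
theorem mono (hz : IsChartSafe T z) {T' : ℝ} (h : T' ≤ T) : IsChartSafe T' z := by
  obtain ⟨ρ, V, hV, hρ, hE, hch⟩ := hz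
  exact ⟨ρ, V, hV, hρ, hE, lt_of_le_of_lt (by nlinarith) hch⟩

/-- **The free flights of the orbit stay in the chart up to the horizon**: for a finite instant
`t_k` and `0 ≤ t` with `t_k + t ≤ T + 1`, all positions of `S_t z_k` have norm `< 1/4`. [folklore] -/
theorem freeFlight_stateAfter_lt (hz : IsChartSafe T z) {k : ℕ}
    (hk : collisionInstant (Euclidean.geometry d) ε z k ≠ ∞) {t : ℝ} (ht : 0 ≤ t)
    (hth : (collisionInstant (Euclidean.geometry d) ε z k).toReal + t ≤ T + 1) (i : Fin N) :
    ‖(freeFlight (Euclidean.geometry d) t (stateAfter (Euclidean.geometry d) ε z k) i).1‖ < 4⁻¹ := by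
  obtain ⟨ρ, V, hV, hρ, hE, hch⟩ := hz
  have hv : ‖(stateAfter (Euclidean.geometry d) ε z k i).2‖ ≤ V :=
    norm_vel_le_of_configEnergy_le hV (by rw [configEnergy_stateAfter]; exact hE) i
  calc ‖(freeFlight (Euclidean.geometry d) t (stateAfter (Euclidean.geometry d) ε z k) i).1‖
      ≤ ‖(stateAfter (Euclidean.geometry d) ε z k i).1‖ +
          |t| * ‖(stateAfter (Euclidean.geometry d) ε z k i).2‖ := norm_fst_freeFlight_le _ _ i
    _ ≤ (ρ + (collisionInstant (Euclidean.geometry d) ε z k).toReal * V) + t * V := by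
        rw [abs_of_nonneg ht]
        exact add_le_add (norm_fst_stateAfter_le hρ hE hV hk i) (mul_le_mul_of_nonneg_left hv ht)
    _ = ρ + ((collisionInstant (Euclidean.geometry d) ε z k).toReal + t) * V := by ring
    _ ≤ ρ + (T + 1) * V := by nlinarith
    _ < 4⁻¹ := hch

/-- **Transfer of the collision-by-collision dynamics below the horizon**: as long as the `k`-th
collision instant of either dynamics is `< T + 1`, the instants agree and the torus state is the
projection of the Euclidean one. [folklore] -/
theorem transfer_stateAfter (hz : IsChartSafe T z) (k : ℕ)
    (hk : collisionInstant (Euclidean.geometry d) ε z k < ENNReal.ofReal (T + 1) ∨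
      collisionInstant (Torus.geometry d) ε (projConfig z) k < ENNReal.ofReal (T + 1)) :
    collisionInstant (Torus.geometry d) ε (projConfig z) k =
        collisionInstant (Euclidean.geometry d) ε z k ∧
      stateAfter (Torus.geometry d) ε (projConfig z) k =
        projConfig (stateAfter (Euclidean.geometry d) ε z k) := by
  induction k with
  | zero => simp
  | succ k ih =>
    have hk' : collisionInstant (Euclidean.geometry d) ε z k < ENNReal.ofReal (T + 1) ∨
        collisionInstant (Torus.geometry d) ε (projConfig z) k < ENNReal.ofReal (T + 1) :=
      hk.imp (fun h => (monotone_collisionInstant _ k.le_succ).trans_lt h)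
        (fun h => (monotone_collisionInstant _ k.le_succ).trans_lt h)
    obtain ⟨hinst, hstate⟩ := ih hk'
    have hkE : collisionInstant (Euclidean.geometry d) ε z k < ENNReal.ofReal (T + 1) := by
      rcases hk' with h | h
      · exact h
      · rwa [hinst] at h
    have hfin : collisionInstant (Euclidean.geometry d) ε z k ≠ ∞ := hkE.ne_top
    set tk := (collisionInstant (Euclidean.geometry d) ε z k).toReal with htk_def
    have hsafe : ∀ t : ℝ, 0 ≤ t → t < T + 1 - tk → ∀ i,
        ‖(freeFlight (Euclidean.geometry d) t (stateAfter (Euclidean.geometry d) ε z k) i).1‖ < 4⁻¹ :=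
      fun t ht hlt i => hz.freeFlight_stateAfter_lt hfin ht (by linarith) i
    have hsplit : ENNReal.ofReal (T + 1) =
        collisionInstant (Euclidean.geometry d) ε z k + ENNReal.ofReal (T + 1 - tk) := by
      have htk : tk < T + 1 := by
        have h := hkE
        rw [← ENNReal.ofReal_toReal hfin] at h
        exact (ENNReal.ofReal_lt_ofReal_iff_of_nonneg ENNReal.toReal_nonneg).1 h
      rw [← ENNReal.ofReal_toReal hfin, ← htk_def, ← ENNReal.ofReal_add ENNReal.toReal_nonneg
        (by linarith), add_sub_cancel]
    -- one of the exit times is below the chart horizon, hence both, and they agree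
    have hτ_or : freeExitTime (Euclidean.geometry d) ε (stateAfter (Euclidean.geometry d) ε z k) <
          ENNReal.ofReal (T + 1 - tk) ∨
        freeExitTime (Torus.geometry d) ε
          (projConfig (stateAfter (Euclidean.geometry d) ε z k)) < ENNReal.ofReal (T + 1 - tk) := by
      rcases hk with h | h
      · rw [collisionInstant_succ, hsplit, ENNReal.add_lt_add_iff_left hfin] at h
        exact Or.inl h
      · rw [collisionInstant_succ, hinst, hstate, hsplit, ENNReal.add_lt_add_iff_left hfin] at h
        exact Or.inr h
    have hτ : freeExitTime (Torus.geometry d) ε (projConfig (stateAfter (Euclidean.geometry d) ε z k)) =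
        freeExitTime (Euclidean.geometry d) ε (stateAfter (Euclidean.geometry d) ε z k) := by
      rcases hτ_or with h | h
      · exact freeExitTime_projConfig_eq_of_lt hsafe h
      · exact freeExitTime_projConfig_eq_of_lt' hsafe h
    have hτlt : freeExitTime (Euclidean.geometry d) ε (stateAfter (Euclidean.geometry d) ε z k) <
        ENNReal.ofReal (T + 1 - tk) := by
      rcases hτ_or with h | h
      · exact h
      · rwa [hτ] at h
    refine ⟨by rw [collisionInstant_succ, collisionInstant_succ, hinst, hstate, hτ], ?_⟩
    rw [stateAfter_succ, stateAfter_succ, hstate]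
    exact projConfig_collisionStep hτ hτlt.ne_top
      (hsafe _ ENNReal.toReal_nonneg (ENNReal.toReal_lt_of_lt_ofReal hτlt))

/-- For every datum and time, the instant of the last counted collision is `≤ t`. [folklore] -/
theorem _root_.Literature.Analysis.FluidPDE.Alexander.collisionInstant_collisionCount_le
    {X : Type*} {G : Geometry d X} (y : Config N d X) (t : ℝ) :
    collisionInstant G ε y (collisionCount G ε y t) ≤ ENNReal.ofReal t := by
  by_cases hb : BddAbove {k : ℕ | collisionInstant G ε y k ≤ ENNReal.ofReal t}
  · exact Nat.sSup_mem ⟨0, by simp⟩ hb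
  · rw [collisionCount, Nat.sSup_of_not_bddAbove hb]
    simp

/-- For every datum and time, the instant of the last collision counted strictly before `t` is
`≤ t`. [folklore] -/
theorem _root_.Literature.Analysis.FluidPDE.Alexander.collisionInstant_collisionCountBefore_le
    {X : Type*} {G : Geometry d X} (y : Config N d X) (t : ℝ) :
    collisionInstant G ε y (collisionCountBefore G ε y t) ≤ ENNReal.ofReal t := by
  by_cases hne : {k : ℕ | collisionInstant G ε y k < ENNReal.ofReal t}.Nonempty
  · by_cases hb : BddAbove {k : ℕ | collisionInstant G ε y k < ENNReal.ofReal t}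
    · exact le_of_lt (Nat.sSup_mem hne hb)
    · rw [collisionCountBefore, Nat.sSup_of_not_bddAbove hb]
      simp
  · rw [collisionCountBefore, Set.not_nonempty_iff_eq_empty.1 hne, csSup_empty]
    simp

/-- `ofReal t < ofReal (T + 1)` for `t ≤ T`, `0 ≤ T`. [folklore] -/
theorem _root_.Literature.Analysis.FluidPDE.Alexander.ofReal_lt_ofReal_add_one {t T : ℝ}
    (hT : 0 ≤ T) (ht : t ≤ T) : ENNReal.ofReal t < ENNReal.ofReal (T + 1) :=
  (ENNReal.ofReal_le_ofReal ht).trans_lt ((ENNReal.ofReal_lt_ofReal_iff (by linarith)).2 (by linarith))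

/-- Up to the horizon the collision counts of the two dynamics agree. [folklore] -/
theorem collisionCount_projConfig (hz : IsChartSafe T z) (hT : 0 ≤ T) {t : ℝ} (ht : t ≤ T) :
    collisionCount (Torus.geometry d) ε (projConfig z) t = collisionCount (Euclidean.geometry d) ε z t := by
  have hlt := ofReal_lt_ofReal_add_one hT ht
  unfold collisionCount
  congr 1
  ext k
  simp only [mem_setOf_eq]
  constructor
  · intro h; rwa [← (hz.transfer_stateAfter k (Or.inr (h.trans_lt hlt))).1]
  · intro h; rwa [(hz.transfer_stateAfter k (Or.inl (h.trans_lt hlt))).1]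

/-- Up to the horizon the strict collision counts of the two dynamics agree. [folklore] -/
theorem collisionCountBefore_projConfig (hz : IsChartSafe T z) (hT : 0 ≤ T) {t : ℝ} (ht : t ≤ T) :
    collisionCountBefore (Torus.geometry d) ε (projConfig z) t =
      collisionCountBefore (Euclidean.geometry d) ε z t := by
  have hlt := ofReal_lt_ofReal_add_one hT ht
  unfold collisionCountBefore
  congr 1
  ext k
  simp only [mem_setOf_eq]
  constructor
  · intro h; rwa [← (hz.transfer_stateAfter k (Or.inr (h.trans hlt))).1]
  · intro h; rwa [(hz.transfer_stateAfter k (Or.inl (h.trans hlt))).1]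

/-- **The forward flows agree up to the horizon**: `P (Φ^E_t z) = Φ^T_t (P z)` for `t ≤ T`. [folklore] -/
theorem projConfig_fwdFlow (hz : IsChartSafe T z) (hT : 0 ≤ T) {t : ℝ} (ht : t ≤ T) :
    projConfig (fwdFlow (Euclidean.geometry d) ε z t) = fwdFlow (Torus.geometry d) ε (projConfig z) t := by
  rw [fwdFlow, fwdFlow, hz.collisionCount_projConfig hT ht]
  have hk : collisionInstant (Euclidean.geometry d) ε z (collisionCount (Euclidean.geometry d) ε z t) <
      ENNReal.ofReal (T + 1) :=
    (collisionInstant_collisionCount_le z t).trans_lt (ofReal_lt_ofReal_add_one hT ht)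
  obtain ⟨hinst, hstate⟩ := hz.transfer_stateAfter _ (Or.inl hk)
  rw [hinst, hstate, projConfig_freeFlight]

/-- **The left-continuous forward flows agree up to the horizon.** [folklore] -/
theorem projConfig_fwdFlowLeft (hz : IsChartSafe T z) (hT : 0 ≤ T) {t : ℝ} (ht : t ≤ T) :
    projConfig (fwdFlowLeft (Euclidean.geometry d) ε z t) =
      fwdFlowLeft (Torus.geometry d) ε (projConfig z) t := by
  rw [fwdFlowLeft, fwdFlowLeft, hz.collisionCountBefore_projConfig hT ht]
  have hk : collisionInstant (Euclidean.geometry d) ε z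
      (collisionCountBefore (Euclidean.geometry d) ε z t) < ENNReal.ofReal (T + 1) :=
    (collisionInstant_collisionCountBefore_le z t).trans_lt (ofReal_lt_ofReal_add_one hT ht)
  obtain ⟨hinst, hstate⟩ := hz.transfer_stateAfter _ (Or.inl hk)
  rw [hinst, hstate, projConfig_freeFlight]

/-- **The two-sided flows agree up to the horizon**: `P (T^t_E z) = T^t_T (P z)` for `|t| ≤ T`
(backward times through the velocity flip, which commutes with `P`). [folklore] -/
theorem projConfig_flow (hz : IsChartSafe T z) (hT : 0 ≤ T) {t : ℝ} (ht : |t| ≤ T) :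
    projConfig (flow (Euclidean.geometry d) ε t z) = flow (Torus.geometry d) ε t (projConfig z) := by
  rcases le_or_gt 0 t with h0 | h0
  · rw [flow_of_nonneg h0, flow_of_nonneg h0, hz.projConfig_fwdFlow hT ((le_abs_self t).trans ht)]
  · rw [abs_of_neg h0] at ht
    rw [flow_of_neg h0, flow_of_neg h0, ← projConfig_flipVel, ← hz.flipVel.projConfig_fwdFlowLeft hT ht,
      projConfig_flipVel]

/-- Arithmetic of instants: `a + b ≤ ofReal T` with `0 ≤ T` gives `a.toReal + b.toReal ≤ T`. [folklore] -/
theorem _root_.Literature.Analysis.FluidPDE.Alexander.toReal_add_toReal_le {a b : ℝ≥0∞} {T : ℝ}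
    (hT : 0 ≤ T) (h : a + b ≤ ENNReal.ofReal T) : a.toReal + b.toReal ≤ T := by
  have hab : a + b ≠ ∞ := ne_top_of_le_ne_top ENNReal.ofReal_ne_top h
  rw [← ENNReal.toReal_add (ENNReal.add_ne_top.1 hab).1 (ENNReal.add_ne_top.1 hab).2]
  exact ENNReal.toReal_le_of_le_ofReal hT h

/-- Arithmetic of instants: if `t_k + ofReal t ≤ ofReal T` (with `t_k` the finite `k`-th
Euclidean instant) then `ofReal t` is below the chart horizon `T + 1 - t_k`. [folklore] -/
theorem ofReal_lt_chartHorizon (hT : 0 ≤ T) {k : ℕ} {t : ℝ}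
    (hkt : collisionInstant (Euclidean.geometry d) ε z k + ENNReal.ofReal t ≤ ENNReal.ofReal T) :
    ENNReal.ofReal t <
      ENNReal.ofReal (T + 1 - (collisionInstant (Euclidean.geometry d) ε z k).toReal) := by
  have hkle : collisionInstant (Euclidean.geometry d) ε z k ≤ ENNReal.ofReal T := le_self_add.trans hkt
  have hfin : collisionInstant (Euclidean.geometry d) ε z k ≠ ∞ :=
    ne_top_of_le_ne_top ENNReal.ofReal_ne_top hkle
  set tk := (collisionInstant (Euclidean.geometry d) ε z k).toReal with htk_def
  have htk : tk ≤ T := ENNReal.toReal_le_of_le_ofReal hT hkle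
  have hsplit : ENNReal.ofReal (T + 1) = collisionInstant (Euclidean.geometry d) ε z k +
      ENNReal.ofReal (T + 1 - tk) := by
    rw [← ENNReal.ofReal_toReal hfin, ← htk_def, ← ENNReal.ofReal_add ENNReal.toReal_nonneg
      (by linarith), add_sub_cancel]
  rw [← ENNReal.add_lt_add_iff_left hfin, ← hsplit]
  exact hkt.trans_lt ((ENNReal.ofReal_lt_ofReal_iff (by linarith)).2 (by linarith))

/-- Below the horizon, a time before the Euclidean exit of `z_k` is before the torus exit of
`P z_k`. [folklore] -/
theorem lt_freeExitTime_projConfig (hz : IsChartSafe T z) (hT : 0 ≤ T) {k : ℕ} {t : ℝ}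
    (hkt : collisionInstant (Euclidean.geometry d) ε z k + ENNReal.ofReal t ≤ ENNReal.ofReal T)
    (ht : ENNReal.ofReal t <
      freeExitTime (Euclidean.geometry d) ε (stateAfter (Euclidean.geometry d) ε z k)) :
    ENNReal.ofReal t < freeExitTime (Torus.geometry d) ε
      (projConfig (stateAfter (Euclidean.geometry d) ε z k)) := by
  have hkle : collisionInstant (Euclidean.geometry d) ε z k ≤ ENNReal.ofReal T := le_self_add.trans hkt
  have hfin : collisionInstant (Euclidean.geometry d) ε z k ≠ ∞ :=
    ne_top_of_le_ne_top ENNReal.ofReal_ne_top hkle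
  have hsafe : ∀ s : ℝ, 0 ≤ s → s < T + 1 - (collisionInstant (Euclidean.geometry d) ε z k).toReal →
      ∀ i, ‖(freeFlight (Euclidean.geometry d) s (stateAfter (Euclidean.geometry d) ε z k) i).1‖ <
        4⁻¹ :=
    fun s hs hlt i => hz.freeFlight_stateAfter_lt hfin hs (by linarith) i
  calc ENNReal.ofReal t
      < min (freeExitTime (Euclidean.geometry d) ε (stateAfter (Euclidean.geometry d) ε z k))
          (ENNReal.ofReal (T + 1 - (collisionInstant (Euclidean.geometry d) ε z k).toReal)) :=
        lt_min ht (ofReal_lt_chartHorizon hT hkt)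
    _ = min (freeExitTime (Torus.geometry d) ε (projConfig (stateAfter (Euclidean.geometry d) ε z k)))
          (ENNReal.ofReal (T + 1 - (collisionInstant (Euclidean.geometry d) ε z k).toReal)) :=
        (min_freeExitTime_projConfig hsafe).symm
    _ ≤ _ := min_le_left _ _

/-- Below the horizon, a time before the torus exit of `P z_k` is before the Euclidean exit of
`z_k`. [folklore] -/
theorem lt_freeExitTime_of_projConfig (hz : IsChartSafe T z) (hT : 0 ≤ T) {k : ℕ} {t : ℝ}
    (hkt : collisionInstant (Euclidean.geometry d) ε z k + ENNReal.ofReal t ≤ ENNReal.ofReal T)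
    (ht : ENNReal.ofReal t < freeExitTime (Torus.geometry d) ε
      (projConfig (stateAfter (Euclidean.geometry d) ε z k))) :
    ENNReal.ofReal t <
      freeExitTime (Euclidean.geometry d) ε (stateAfter (Euclidean.geometry d) ε z k) := by
  have hkle : collisionInstant (Euclidean.geometry d) ε z k ≤ ENNReal.ofReal T := le_self_add.trans hkt
  have hfin : collisionInstant (Euclidean.geometry d) ε z k ≠ ∞ :=
    ne_top_of_le_ne_top ENNReal.ofReal_ne_top hkle
  have hsafe : ∀ s : ℝ, 0 ≤ s → s < T + 1 - (collisionInstant (Euclidean.geometry d) ε z k).toReal →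
      ∀ i, ‖(freeFlight (Euclidean.geometry d) s (stateAfter (Euclidean.geometry d) ε z k) i).1‖ <
        4⁻¹ :=
    fun s hs hlt i => hz.freeFlight_stateAfter_lt hfin hs (by linarith) i
  calc ENNReal.ofReal t
      < min (freeExitTime (Torus.geometry d) ε (projConfig (stateAfter (Euclidean.geometry d) ε z k)))
          (ENNReal.ofReal (T + 1 - (collisionInstant (Euclidean.geometry d) ε z k).toReal)) :=
        lt_min ht (ofReal_lt_chartHorizon hT hkt)
    _ = min (freeExitTime (Euclidean.geometry d) ε (stateAfter (Euclidean.geometry d) ε z k))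
          (ENNReal.ofReal (T + 1 - (collisionInstant (Euclidean.geometry d) ε z k).toReal)) :=
        min_freeExitTime_projConfig hsafe
    _ ≤ _ := min_le_left _ _

/-- Below the horizon the exit configuration of the `k`-th Euclidean state lies in the chart. [folklore] -/
theorem freeFlight_freeExitTime_stateAfter_lt (hz : IsChartSafe T z) (hT : 0 ≤ T) {k : ℕ}
    (hk1 : collisionInstant (Euclidean.geometry d) ε z (k + 1) ≤ ENNReal.ofReal T) (i : Fin N) :
    ‖(freeFlight (Euclidean.geometry d)
      (freeExitTime (Euclidean.geometry d) ε (stateAfter (Euclidean.geometry d) ε z k)).toReal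
      (stateAfter (Euclidean.geometry d) ε z k) i).1‖ < 4⁻¹ := by
  rw [collisionInstant_succ] at hk1
  have hfin : collisionInstant (Euclidean.geometry d) ε z k ≠ ∞ :=
    ne_top_of_le_ne_top ENNReal.ofReal_ne_top (le_self_add.trans hk1)
  have hsum := toReal_add_toReal_le hT hk1
  exact hz.freeFlight_stateAfter_lt hfin ENNReal.toReal_nonneg (by linarith) i

/-- **Truncated forward regularity transfers**: for a chart-safe datum, the torus dynamics of
`P z` is forward regular up to time `T` iff the Euclidean dynamics of `z` is. [folklore] -/
theorem fwdGoodUpTo_projConfig_iff (hz : IsChartSafe T z) (hT : 0 ≤ T) :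
    FwdGoodUpTo (Torus.geometry d) ε T (projConfig z) ↔ FwdGoodUpTo (Euclidean.geometry d) ε T z := by
  have hTH : ENNReal.ofReal T < ENNReal.ofReal (T + 1) := ofReal_lt_ofReal_add_one hT le_rfl
  -- the exit times of corresponding states agree below the horizon
  have hτ_of : ∀ k : ℕ, collisionInstant (Euclidean.geometry d) ε z (k + 1) ≤ ENNReal.ofReal T →
      freeExitTime (Torus.geometry d) ε (projConfig (stateAfter (Euclidean.geometry d) ε z k)) =
        freeExitTime (Euclidean.geometry d) ε (stateAfter (Euclidean.geometry d) ε z k) := by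
    intro k hk1
    obtain ⟨hinst1, -⟩ := hz.transfer_stateAfter (k + 1) (Or.inl (hk1.trans_lt hTH))
    have hkle : collisionInstant (Euclidean.geometry d) ε z k ≤ ENNReal.ofReal T :=
      (monotone_collisionInstant _ k.le_succ).trans hk1
    obtain ⟨hinst, hstate⟩ := hz.transfer_stateAfter k (Or.inl (hkle.trans_lt hTH))
    have hfin : collisionInstant (Euclidean.geometry d) ε z k ≠ ∞ :=
      ne_top_of_le_ne_top ENNReal.ofReal_ne_top hkle
    rw [collisionInstant_succ, collisionInstant_succ, hinst, hstate] at hinst1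
    exact (ENNReal.add_right_inj hfin).1 hinst1
  constructor
  · rintro ⟨h1, h2, h3⟩
    refine ⟨fun k hk1 => ?_, fun k t ht0 htτ hkt i j hij => ?_, ?_⟩
    · obtain ⟨hinst1, -⟩ := hz.transfer_stateAfter (k + 1) (Or.inl (hk1.trans_lt hTH))
      have hkle : collisionInstant (Euclidean.geometry d) ε z k ≤ ENNReal.ofReal T :=
        (monotone_collisionInstant _ k.le_succ).trans hk1
      obtain ⟨-, hstate⟩ := hz.transfer_stateAfter k (Or.inl (hkle.trans_lt hTH))
      have key := h1 k (by rwa [hinst1])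
      rwa [hstate, hτ_of k hk1, ← projConfig_freeFlight,
        isSimpleIncoming_projConfig_iff (hz.freeFlight_freeExitTime_stateAfter_lt hT hk1)] at key
    · have hkle : collisionInstant (Euclidean.geometry d) ε z k ≤ ENNReal.ofReal T :=
        le_self_add.trans hkt
      obtain ⟨hinst, hstate⟩ := hz.transfer_stateAfter k (Or.inl (hkle.trans_lt hTH))
      have hfin : collisionInstant (Euclidean.geometry d) ε z k ≠ ∞ :=
        ne_top_of_le_ne_top ENNReal.ofReal_ne_top hkle
      have hsum := toReal_add_toReal_le hT hkt
      rw [ENNReal.toReal_ofReal ht0.le] at hsum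
      have hchart : ∀ i, ‖(freeFlight (Euclidean.geometry d) t
          (stateAfter (Euclidean.geometry d) ε z k) i).1‖ < 4⁻¹ :=
        hz.freeFlight_stateAfter_lt hfin ht0.le (by linarith)
      rw [← projConfig_mem_contactSet_iff hchart, projConfig_freeFlight, ← hstate]
      refine h2 k t ht0 ?_ (by rwa [hinst]) i j hij
      rw [hstate]
      exact hz.lt_freeExitTime_projConfig hT hkt htτ
    · obtain ⟨k, hk⟩ := h3
      refine ⟨k, ?_⟩
      by_contra hle
      have hle' := not_lt.1 hle
      rw [(hz.transfer_stateAfter k (Or.inl (hle'.trans_lt hTH))).1] at hk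
      exact hle hk
  · rintro ⟨h1, h2, h3⟩
    refine ⟨fun k hk1 => ?_, fun k t ht0 htτ hkt i j hij => ?_, ?_⟩
    · obtain ⟨hinst1, -⟩ := hz.transfer_stateAfter (k + 1) (Or.inr (hk1.trans_lt hTH))
      rw [hinst1] at hk1
      have hkle : collisionInstant (Euclidean.geometry d) ε z k ≤ ENNReal.ofReal T :=
        (monotone_collisionInstant _ k.le_succ).trans hk1
      obtain ⟨-, hstate⟩ := hz.transfer_stateAfter k (Or.inl (hkle.trans_lt hTH))
      rw [hstate, hτ_of k hk1, ← projConfig_freeFlight,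
        isSimpleIncoming_projConfig_iff (hz.freeFlight_freeExitTime_stateAfter_lt hT hk1)]
      exact h1 k hk1
    · have hkleT : collisionInstant (Torus.geometry d) ε (projConfig z) k ≤ ENNReal.ofReal T :=
        le_self_add.trans hkt
      obtain ⟨hinst, hstate⟩ := hz.transfer_stateAfter k (Or.inr (hkleT.trans_lt hTH))
      rw [hinst] at hkt
      rw [hstate] at htτ ⊢
      have hkle : collisionInstant (Euclidean.geometry d) ε z k ≤ ENNReal.ofReal T :=
        le_self_add.trans hkt
      have hfin : collisionInstant (Euclidean.geometry d) ε z k ≠ ∞ :=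
        ne_top_of_le_ne_top ENNReal.ofReal_ne_top hkle
      have hsum := toReal_add_toReal_le hT hkt
      rw [ENNReal.toReal_ofReal ht0.le] at hsum
      have hchart : ∀ i, ‖(freeFlight (Euclidean.geometry d) t
          (stateAfter (Euclidean.geometry d) ε z k) i).1‖ < 4⁻¹ :=
        hz.freeFlight_stateAfter_lt hfin ht0.le (by linarith)
      rw [← projConfig_freeFlight, projConfig_mem_contactSet_iff hchart]
      exact h2 k t ht0 (hz.lt_freeExitTime_of_projConfig hT hkt htτ) hkt i j hij
    · obtain ⟨k, hk⟩ := h3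
      refine ⟨k, ?_⟩
      by_contra hle
      have hle' := not_lt.1 hle
      rw [← (hz.transfer_stateAfter k (Or.inr (hle'.trans_lt hTH))).1] at hk
      exact hle hk

end IsChartSafe

/-! ### The truncated good set and its transfer -/

/-- The truncated good sets of `ℝ^d` are invariant under rescaling by `c > 0`. [folklore] -/
theorem smul_mem_goodUpTo_iff {c : ℝ} (hc : 0 < c) :
    c • z ∈ goodUpTo (Euclidean.geometry d) (c * ε) T ↔ z ∈ goodUpTo (Euclidean.geometry d) ε T := by
  simp only [goodUpTo, mem_setOf_eq, smul_mem_hardSphereDomain_iff hc, smul_mem_contactSet_iff hc,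
    isOutgoing_smul_iff hc.ne', fwdGoodUpTo_smul_iff hc, flipVel_smul]

/-- **Transfer of the truncated good set**: a chart-safe datum of `ℝ^d` is in `Γ₀^E(T)` iff its
projection is in `Γ₀^T(T)`. [folklore] -/
theorem IsChartSafe.projConfig_mem_goodUpTo_iff (hz : IsChartSafe T z) (hT : 0 ≤ T) :
    projConfig z ∈ goodUpTo (Torus.geometry d) ε T ↔ z ∈ goodUpTo (Euclidean.geometry d) ε T := by
  have hz0 : ∀ i, ‖(z i).1‖ < 4⁻¹ := hz.norm_fst_lt hT
  simp only [goodUpTo, mem_setOf_eq, projConfig_mem_hardSphereDomain_iff hz0,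
    projConfig_conventions_iff hz0, hz.fwdGoodUpTo_projConfig_iff hT, ← projConfig_flipVel,
    hz.flipVel.fwdGoodUpTo_projConfig_iff hT]

end Bounded

end Alexander

end Projection
end Kinetic

end

end Literature.Analysis.FluidPDE
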